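import Summits.Ventures.CertifiedManyBodySolver.Observables.PairLROTowerWitnessStationary
import Summits.Ventures.CertifiedManyBodySolver.Observables.PairLROTowerCeiling
import Literature.MathematicalPhysics.QuantumLattice.VariationalStationarity
import Literature.MathematicalPhysics.QuantumLattice.LocalUnitaryDressedSlaterBound
import HarnessLib

/-!
# OP1-S without the licence, part 1: the finite-volume tower step with an equation-of-motion slack,
# and the Hermitian splitting of the eom operator

HONEST FRAMING: first certified bounds on pairing observables; not a superconductivity verdict; a ceiling
route, never presence. Crew hubbard-obs (D-0042), seat hubbard-obs-p1 (`prover-hubbard-obs-p1-g6-0`).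
Zero compute; no definition; no named fact; no `sorry`.

`tower_finite_step` (PairLROTowerCeiling) reads a one-point bound (OP1) valid for EVERY unit vector `ζ` of
the torus — the soundness class OP1-E of the gauge-broken reduced-density-matrix bootstrap (positivity +
translations/point group + filling rows + energy window), in which the stationarity rows `ω([H, X]) = 0`
are NOT available (`ζ` is no eigenvector). Here the (OP1) inequality may carry the additional slack term
`Re⟨ζ, (H W − W H) ζ⟩/L²` for a number-conserving `W = B₁ + iB₂` — the certificate may use neutral
equation-of-motion rows with arbitrary multipliers — and the tower inequality survives with an extra
`(√(2ε₀D₁) + √(2ε₀D₂))/L`, `D_i·L²` the double-commutator constants of `B_i`, `ε₀ = O(1)` the excess of the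
tower levels over the minima of their own particle-number sectors (finite-volume Pusz–Woronowicz /
Bratteli–Kishimoto–Robinson, `VariationalStationarity`; no chemical potential, no sector convexity).

* `tower_finite_step_S` — one torus, abstract eom operator `W = B₁ + iB₂`;
* `eom_translationSum_decomposition` — for a local `w` commuting with the particle number of its window,
  the translation sum `Σ_v T_v Γ_L(w)` splits as `B₁ + iB₂` with `B₁, B₂` Hermitian, number-conserving
  translation sums of local observables.
Part 2 (PairLROTowerStationary): the family theorem `liminf_pairFieldLRO_le_sq_of_onePoint_stationary_bound_TT'`.

References: T. Koma, H. Tasaki, J. Stat. Phys. 76 (1994) 745, Theorem 5, §4 [KomaTasaki1994]; W. Pusz,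
S. L. Woronowicz, Comm. Math. Phys. 58 (1978) 273, §1 [PuszWoronowicz1978]; X. Han, arXiv:2006.06002,
§2–3 (equation-of-motion constraints `⟨[H, O]⟩ = 0`) [Han2020Bootstrap].
-/

noncomputable section

namespace Summit.Ventures.CertifiedManyBodySolver.Observables

open Matrix Complex Finset Literature.MathematicalPhysics.QuantumLattice Literature.Probability.LatticeModels
open Literature.MathematicalPhysics.QuantumLattice.HubbardWave0 ThermodynamicLimit Filter Topology
open Literature.MathematicalPhysics.QuantumManyBody.StateRelaxation
open scoped ComplexOrder ComplexConjugate BigOperators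

/-! ### §1  One torus: the tower step with an equation-of-motion slack -/

section Finite

variable {L : ℕ} [NeZero L] (g : Site 2 → ℝ)

/-- **The finite-volume tower step with eom slack.** Data of `tower_finite_step` (unit sector ground state
`ψ` of `H = hubbardTorusTT' L t t' U` in `(N, S^z = 0)`, LRO floor `c₀L⁴ ≤ Re⟨ψ,Δ†Δψ⟩`, constants
`Cα, Cκ, Cγ`, `(k+1)Cγ ≤ (c₀/2)L²`, `κ ≥ 0`), PLUS: an operator `W = B₁ + iB₂` with `B₁, B₂` Hermitian and
number conserving, double-commutator bounds `|Re⟨χ,[B_i,[B_i,H]]χ⟩| ≤ D_i·L²` on unit `χ`, and a sector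
floor `E − C_fl ≤ Re⟨χ,Hχ⟩` for the unit vectors of the sectors `N + 2m`, `m ≤ k`
(`E = minEnergyOn (szSector N 0)`). If the one-point bound (OP1-S) — (OP1) with the extra term
`Re⟨ζ,(HW − WH)ζ⟩/L²` on the left — holds for every unit `ζ`, then
`(k/(k+1))√(c₀ − (k+1)Cγ/L²) ≤ −(c − A + (Σμ)((N/2)/L² − ν) + κ(u − E/L²)) + K/L² + (√(2ε₀D₁) + √(2ε₀D₂))/L`,
`K` as in `tower_finite_step`, `ε₀ = D̄ + C_fl`, `D̄ = (Cκ/√(c₀/2))Σ_{i<k}(Cα/√(c₀/2))^i`.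
[cite: KomaTasaki1994, Theorem 5 and §4] [cite: PuszWoronowicz1978, §1] [cite: Han2020Bootstrap, §2] -/
theorem tower_finite_step_S (t t' U : ℝ) {N : ℕ} {ψ : Fock (Orb (FermionTorus 2 L))}
    (hψ1 : star ψ ⬝ᵥ ψ = 1) (hgs : IsGroundStateInSector (hubbardTorusTT' L t t' U) N 0 ψ)
    {c A κ u ν c₀ Cα Cκ Cγ : ℝ} (μ : Fin 2 → ℝ) (hκ : 0 ≤ κ) (hc₀ : 0 < c₀) (hCα : 0 ≤ Cα) (hCκ : 0 ≤ Cκ)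
    (hCγ : 0 ≤ Cγ) (k : ℕ)
    (hα : ∀ φ : Fock (Orb (FermionTorus 2 L)),
      eucNorm ((pairField g L)ᴴ *ᵥ φ) ≤ Cα * (L : ℝ) ^ 2 * eucNorm φ)
    (hκ' : ∀ φ : Fock (Orb (FermionTorus 2 L)),
      eucNorm ((hubbardTorusTT' L t t' U * (pairField g L)ᴴ - (pairField g L)ᴴ * hubbardTorusTT' L t t' U) *ᵥ φ) ≤
        Cκ * (L : ℝ) ^ 2 * eucNorm φ)
    (hγ : ∀ φ : Fock (Orb (FermionTorus 2 L)), star φ ⬝ᵥ φ = 1 →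
      |(expect (pairField g L * (pairField g L)ᴴ - (pairField g L)ᴴ * pairField g L) φ).re| ≤ Cγ * (L : ℝ) ^ 2)
    (hlro : c₀ * (L : ℝ) ^ 4 ≤ (expect ((pairField g L)ᴴ * pairField g L) ψ).re)
    (hLbig : (k + 1) * Cγ ≤ (c₀ / 2) * (L : ℝ) ^ 2)
    -- the equation-of-motion operator
    (W B₁ B₂ : Matrix (Finset (Orb (FermionTorus 2 L))) (Finset (Orb (FermionTorus 2 L))) ℂ)
    (hB₁ : B₁.IsHermitian) (hB₂ : B₂.IsHermitian) (hB₁N : Commute B₁ totalNumber)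
    (hB₂N : Commute B₂ totalNumber) (hWB : W = B₁ + (I : ℂ) • B₂) {D₁ D₂ Cfl : ℝ} (hD₁ : 0 ≤ D₁)
    (hD₂ : 0 ≤ D₂) (hCfl : 0 ≤ Cfl)
    (hDD₁ : ∀ χ : Fock (Orb (FermionTorus 2 L)), star χ ⬝ᵥ χ = 1 →
      |(star χ ⬝ᵥ ((B₁ * (B₁ * hubbardTorusTT' L t t' U - hubbardTorusTT' L t t' U * B₁) -
        (B₁ * hubbardTorusTT' L t t' U - hubbardTorusTT' L t t' U * B₁) * B₁) *ᵥ χ)).re| ≤ D₁ * (L : ℝ) ^ 2)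
    (hDD₂ : ∀ χ : Fock (Orb (FermionTorus 2 L)), star χ ⬝ᵥ χ = 1 →
      |(star χ ⬝ᵥ ((B₂ * (B₂ * hubbardTorusTT' L t t' U - hubbardTorusTT' L t t' U * B₂) -
        (B₂ * hubbardTorusTT' L t t' U - hubbardTorusTT' L t t' U * B₂) * B₂) *ᵥ χ)).re| ≤ D₂ * (L : ℝ) ^ 2)
    (hfl : ∀ m : ℕ, m ≤ k → ∀ χ : Fock (Orb (FermionTorus 2 L)), star χ ⬝ᵥ χ = 1 →
      totalNumber *ᵥ χ = (((N : ℝ) + 2 * (m : ℝ) : ℝ) : ℂ) • χ →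
      (hubbardTorusTT' L t t' U).minEnergyOn (szSector N 0) - Cfl ≤
        (star χ ⬝ᵥ (hubbardTorusTT' L t t' U *ᵥ χ)).re)
    (hboundS : ∀ ζ : Fock (Orb (FermionTorus 2 L)), star ζ ⬝ᵥ ζ = 1 →
      c - A + ∑ σ : Fin 2, μ σ *
          ((star ζ ⬝ᵥ ((∑ y : FermionTorus 2 L, numberOp y σ) *ᵥ ζ)).re / (L : ℝ) ^ 2 - ν) +
        κ * (u - (star ζ ⬝ᵥ (hubbardTorusTT' L t t' U *ᵥ ζ)).re / (L : ℝ) ^ 2) +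
        (star ζ ⬝ᵥ ((hubbardTorusTT' L t t' U * W - W * hubbardTorusTT' L t t' U) *ᵥ ζ)).re / (L : ℝ) ^ 2 ≤
        -((expect (pairField g L) ζ).re / (L : ℝ) ^ 2)) :
    (k : ℝ) / (k + 1) * Real.sqrt (c₀ - (k + 1) * Cγ / (L : ℝ) ^ 2) ≤
      -(c - A + (∑ σ : Fin 2, μ σ) * (((N : ℝ) / 2) / (L : ℝ) ^ 2 - ν) +
          κ * (u - (hubbardTorusTT' L t t' U).minEnergyOn (szSector N 0) / (L : ℝ) ^ 2)) +
        (-(∑ σ : Fin 2, μ σ) * k / 2 +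
          κ * ((Cκ / Real.sqrt (c₀ / 2)) * ∑ i ∈ Finset.range k, (Cα / Real.sqrt (c₀ / 2)) ^ i)) / (L : ℝ) ^ 2 +
        (Real.sqrt (2 * ((Cκ / Real.sqrt (c₀ / 2)) * ∑ i ∈ Finset.range k, (Cα / Real.sqrt (c₀ / 2)) ^ i + Cfl) * D₁) +
          Real.sqrt (2 * ((Cκ / Real.sqrt (c₀ / 2)) * ∑ i ∈ Finset.range k, (Cα / Real.sqrt (c₀ / 2)) ^ i + Cfl) * D₂)) /
          (L : ℝ) := by
  set H := hubbardTorusTT' L t t' U with hH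
  set P := pairField g L with hP
  set E : ℝ := H.minEnergyOn (szSector N 0) with hE
  have hHherm : H.IsHermitian := hubbardTorusTT'_isHermitian L t t' U
  have hL : (0 : ℝ) < (L : ℝ) := Nat.cast_pos.2 (Nat.pos_of_ne_zero (NeZero.ne L))
  have hL2 : (0 : ℝ) < (L : ℝ) ^ 2 := by positivity
  have hHN : H * totalNumber = totalNumber * H := (hubbardTorusTT'_commute_totalNumber L t t' U).eq
  have hNA : (totalNumber : Matrix _ _ ℂ) * Pᴴ - Pᴴ * totalNumber = ((2 : ℝ) : ℂ) • Pᴴ := by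
    have h := commutator_conjTranspose_of_commutator totalNumber_isHermitian (totalNumber_commutator_pairField g L)
    rw [neg_neg] at h; exact h
  have hHψ : H *ᵥ ψ = (E : ℂ) • ψ := hgs.2.2
  have hNψ : (totalNumber : Matrix _ _ ℂ) *ᵥ ψ = ((N : ℝ) : ℂ) • ψ := by
    rw [totalNumber_mulVec_of_isNParticle ((mem_szSector_iff _ _ ψ).1 hgs.1).1]; push_cast; rfl
  set α : ℝ := Cα * (L : ℝ) ^ 2 with hαdef
  set κ₁ : ℝ := Cκ * (L : ℝ) ^ 2 with hκ₁def
  set β : ℝ := Cγ * (L : ℝ) ^ 2 with hβdef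
  have hβ' : ∀ φ : Fock (Orb (FermionTorus 2 L)),
      |(star φ ⬝ᵥ ((Pᴴ * Pᴴᴴ - Pᴴᴴ * Pᴴ) *ᵥ φ)).re| ≤ β * eucNorm φ ^ 2 := by
    intro φ
    rw [conjTranspose_conjTranspose]
    have hunit : ∀ ψ' : Fock (Orb (FermionTorus 2 L)), star ψ' ⬝ᵥ ψ' = 1 →
        |(star ψ' ⬝ᵥ ((Pᴴ * P - P * Pᴴ) *ᵥ ψ')).re| ≤ β := by
      intro ψ' h1
      have h := hγ ψ' h1
      have e : (Pᴴ * P - P * Pᴴ) = -(P * Pᴴ - Pᴴ * P) := by abel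
      rw [e, neg_mulVec, dotProduct_neg, Complex.neg_re, abs_neg]
      exact h
    exact abs_re_quadForm_le_of_unit hunit φ
  set ρ : ℝ := (L : ℝ) ^ 2 * Real.sqrt (c₀ - (k + 1) * Cγ / (L : ℝ) ^ 2) with hρdef
  have hinside : c₀ / 2 ≤ c₀ - (k + 1) * Cγ / (L : ℝ) ^ 2 := by
    have h1 : (k + 1) * Cγ / (L : ℝ) ^ 2 ≤ c₀ / 2 := by
      rw [div_le_iff₀ hL2]; exact hLbig
    linarith
  have hρpos : 0 < ρ := by
    have : 0 < Real.sqrt (c₀ - (k + 1) * Cγ / (L : ℝ) ^ 2) := Real.sqrt_pos.2 (by linarith)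
    positivity
  have hρ2 : ρ ^ 2 + k * β ≤ eucNorm (Pᴴ *ᵥ ψ) ^ 2 := by
    have e1 : eucNorm (Pᴴ *ᵥ ψ) ^ 2 = (expect (P * Pᴴ) ψ).re := by
      rw [eucNorm_sq, star_mulVec, conjTranspose_conjTranspose, ← dotProduct_mulVec, mulVec_mulVec]; rfl
    have e2 : ρ ^ 2 = c₀ * (L : ℝ) ^ 4 - (k + 1) * Cγ * (L : ℝ) ^ 2 := by
      rw [hρdef, mul_pow, Real.sq_sqrt (by linarith), mul_sub, mul_div_assoc']
      have hx : ((L : ℝ) ^ 2) ^ 2 * ((k + 1) * Cγ) / (L : ℝ) ^ 2 = (L : ℝ) ^ 2 * ((k + 1) * Cγ) := by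
        rw [pow_two ((L : ℝ) ^ 2), mul_assoc, mul_div_assoc, mul_div_cancel_left₀ _ hL2.ne']
      rw [hx]
      ring
    have h3 : (expect (Pᴴ * P) ψ).re - Cγ * (L : ℝ) ^ 2 ≤ (expect (P * Pᴴ) ψ).re := by
      have h := (abs_le.1 (hγ ψ hψ1)).1
      have e : expect (P * Pᴴ - Pᴴ * P) ψ = expect (P * Pᴴ) ψ - expect (Pᴴ * P) ψ := by
        simp [Literature.MathematicalPhysics.QuantumLattice.expect, sub_mulVec, dotProduct_sub]
      rw [e, Complex.sub_re] at h
      linarith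
    rw [e1, e2, hβdef]
    nlinarith [hlro, h3]
  obtain ⟨Ξ, hΞ1, -, hΞP, hΞH, hΞG, hΞC⟩ := exists_towerWitness_comm totalNumber_isHermitian hHN
    (by norm_num : (2 : ℝ) ≠ 0) hNA hψ1 hHψ hNψ (by positivity : 0 ≤ α) hα (by positivity : 0 ≤ κ₁) hκ'
    (by positivity : 0 ≤ β) hβ' k hρpos hρ2
  rw [conjTranspose_conjTranspose] at hΞP
  have hΞN : ∀ σ : Fin 2, (star Ξ ⬝ᵥ ((∑ y : FermionTorus 2 L, numberOp y σ) *ᵥ Ξ)).re = (N : ℝ) / 2 + k / 2 := by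
    intro σ
    have hGA : (∑ y : FermionTorus 2 L, numberOp y σ) * Pᴴ - Pᴴ * (∑ y : FermionTorus 2 L, numberOp y σ) =
        ((1 : ℝ) : ℂ) • Pᴴ := by
      have h := commutator_conjTranspose_of_commutator (spinNumber_isHermitian (L := L) σ)
        (spinNumber_commutator_pairField g σ)
      rw [neg_neg] at h; exact h
    have hGψ := spinNumber_mulVec_of_mem_szSector σ hgs.1
    rw [hΞG _ 1 ((N : ℝ) / 2) hGA hGψ, Complex.ofReal_re]
    ring
  have hwin := hboundS Ξ hΞ1
  simp_rw [hΞN] at hwin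
  have hfill : ∑ σ : Fin 2, μ σ * (((N : ℝ) / 2 + k / 2) / (L : ℝ) ^ 2 - ν) =
      (∑ σ : Fin 2, μ σ) * (((N : ℝ) / 2) / (L : ℝ) ^ 2 - ν) + (∑ σ : Fin 2, μ σ) * (k / 2) / (L : ℝ) ^ 2 := by
    rw [Finset.sum_mul, Finset.sum_mul, Finset.sum_div, ← Finset.sum_add_distrib]
    refine Finset.sum_congr rfl fun σ _ => ?_
    ring
  rw [hfill] at hwin
  set Dbar : ℝ := (Cκ / Real.sqrt (c₀ / 2)) * ∑ i ∈ Finset.range k, (Cα / Real.sqrt (c₀ / 2)) ^ i with hDbar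
  have hsqrt_le : (L : ℝ) ^ 2 * Real.sqrt (c₀ / 2) ≤ ρ := by
    rw [hρdef]
    exact mul_le_mul_of_nonneg_left (Real.sqrt_le_sqrt hinside) hL2.le
  have hs0 : 0 < Real.sqrt (c₀ / 2) := Real.sqrt_pos.2 (by linarith)
  have hratio1 : κ₁ / ρ ≤ Cκ / Real.sqrt (c₀ / 2) := by
    rw [hκ₁def, div_le_div_iff₀ hρpos hs0]
    calc Cκ * (L : ℝ) ^ 2 * Real.sqrt (c₀ / 2) = Cκ * ((L : ℝ) ^ 2 * Real.sqrt (c₀ / 2)) := by ring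
      _ ≤ Cκ * ρ := mul_le_mul_of_nonneg_left hsqrt_le hCκ
  have hratio2 : α / ρ ≤ Cα / Real.sqrt (c₀ / 2) := by
    rw [hαdef, div_le_div_iff₀ hρpos hs0]
    calc Cα * (L : ℝ) ^ 2 * Real.sqrt (c₀ / 2) = Cα * ((L : ℝ) ^ 2 * Real.sqrt (c₀ / 2)) := by ring
      _ ≤ Cα * ρ := mul_le_mul_of_nonneg_left hsqrt_le hCα
  have hD_le : (κ₁ / ρ) * ∑ i ∈ Finset.range k, (α / ρ) ^ i ≤ Dbar := by
    rw [hDbar]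
    refine mul_le_mul hratio1 (Finset.sum_le_sum fun i _ => ?_) (Finset.sum_nonneg fun i _ => by positivity)
      (div_nonneg hCκ hs0.le)
    exact pow_le_pow_left₀ (by positivity) hratio2 i
  have hDbar0 : 0 ≤ Dbar := by
    rw [hDbar]
    exact mul_nonneg (div_nonneg hCκ hs0.le) (Finset.sum_nonneg fun i _ => by positivity)
  have heΞ : (star Ξ ⬝ᵥ (H *ᵥ Ξ)).re ≤ E + Dbar := hΞH.trans (by linarith)
  ---------------------------------------------------------------- the equation-of-motion slack
  set ε₀ : ℝ := Dbar + Cfl with hε₀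
  have hε₀0 : 0 ≤ ε₀ := add_nonneg hDbar0 hCfl
  set δ : ℝ := Real.sqrt (2 * ε₀ * (D₁ * (L : ℝ) ^ 2)) + Real.sqrt (2 * ε₀ * (D₂ * (L : ℝ) ^ 2)) with hδ
  have hWN : W * totalNumber = totalNumber * W := by
    rw [hWB, Matrix.add_mul, Matrix.mul_add, Matrix.smul_mul, Matrix.mul_smul, hB₁N.eq, hB₂N.eq]
  have hsector : ∀ m : ℕ, m ≤ k → ∀ χ : Fock (Orb (FermionTorus 2 L)), star χ ⬝ᵥ χ = 1 →
      totalNumber *ᵥ χ = (((N : ℝ) + 2 * (m : ℝ) : ℝ) : ℂ) • χ →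
      (star χ ⬝ᵥ (H *ᵥ χ)).re ≤ E + (κ₁ / ρ) * ∑ i ∈ Finset.range k, (α / ρ) ^ i →
      ‖star χ ⬝ᵥ ((H * W - W * H) *ᵥ χ)‖ ≤ δ := by
    intro m hm χ hχ1 hχN hχE
    have hεχ : (star χ ⬝ᵥ (H *ᵥ χ)).re ≤ (E - Cfl) + ε₀ := by
      rw [hε₀]; linarith [hχE, hD_le]
    exact norm_expect_commutator_le_sqrt_add_sqrt hHherm hB₁ hB₂ hB₁N hB₂N hWB hχ1 hχN
      (by positivity : 0 ≤ D₁ * (L : ℝ) ^ 2) (by positivity : 0 ≤ D₂ * (L : ℝ) ^ 2)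
      (fun χ' hχ'1 hχ'N => hfl m hm χ' hχ'1 hχ'N) hεχ hDD₁ hDD₂
  have heom : |(star Ξ ⬝ᵥ ((H * W - W * H) *ᵥ Ξ)).re| ≤ δ :=
    (Complex.abs_re_le_norm _).trans (hΞC W δ hWN hsector)
  have heom' : -(δ / (L : ℝ) ^ 2) ≤ (star Ξ ⬝ᵥ ((H * W - W * H) *ᵥ Ξ)).re / (L : ℝ) ^ 2 := by
    rw [← neg_div]
    exact div_le_div_of_nonneg_right (abs_le.1 heom).1 hL2.le
  have hδL : δ / (L : ℝ) ^ 2 = (Real.sqrt (2 * ε₀ * D₁) + Real.sqrt (2 * ε₀ * D₂)) / (L : ℝ) := by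
    have e1 : Real.sqrt (2 * ε₀ * (D₁ * (L : ℝ) ^ 2)) = Real.sqrt (2 * ε₀ * D₁) * (L : ℝ) := by
      rw [show 2 * ε₀ * (D₁ * (L : ℝ) ^ 2) = (2 * ε₀ * D₁) * (L : ℝ) ^ 2 by ring,
        Real.sqrt_mul (by positivity), Real.sqrt_sq hL.le]
    have e2 : Real.sqrt (2 * ε₀ * (D₂ * (L : ℝ) ^ 2)) = Real.sqrt (2 * ε₀ * D₂) * (L : ℝ) := by
      rw [show 2 * ε₀ * (D₂ * (L : ℝ) ^ 2) = (2 * ε₀ * D₂) * (L : ℝ) ^ 2 by ring,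
        Real.sqrt_mul (by positivity), Real.sqrt_sq hL.le]
    rw [hδ, e1, e2, ← add_mul, div_eq_div_iff hL2.ne' hL.ne']
    ring
  ---------------------------------------------------------------- assembling
  have hone : (k : ℝ) / (k + 1) * ρ ≤ (expect P Ξ).re := hΞP
  have hρL : ρ / (L : ℝ) ^ 2 = Real.sqrt (c₀ - (k + 1) * Cγ / (L : ℝ) ^ 2) := by
    rw [hρdef, mul_div_cancel_left₀ _ hL2.ne']
  have hen : κ * (u - E / (L : ℝ) ^ 2) - κ * Dbar / (L : ℝ) ^ 2 ≤
      κ * (u - (star Ξ ⬝ᵥ (H *ᵥ Ξ)).re / (L : ℝ) ^ 2) := by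
    have h1 : (star Ξ ⬝ᵥ (H *ᵥ Ξ)).re / (L : ℝ) ^ 2 ≤ E / (L : ℝ) ^ 2 + Dbar / (L : ℝ) ^ 2 := by
      rw [← add_div]; exact div_le_div_of_nonneg_right heΞ hL2.le
    have h2 := mul_le_mul_of_nonneg_left h1 hκ
    rw [mul_add] at h2
    have e : κ * Dbar / (L : ℝ) ^ 2 = κ * (Dbar / (L : ℝ) ^ 2) := by ring
    rw [e]
    linarith
  have hop : (k : ℝ) / (k + 1) * Real.sqrt (c₀ - (k + 1) * Cγ / (L : ℝ) ^ 2) ≤ (expect P Ξ).re / (L : ℝ) ^ 2 := by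
    rw [← hρL, ← mul_div_assoc]
    exact div_le_div_of_nonneg_right hone hL2.le
  have e3 : (-(∑ σ : Fin 2, μ σ) * k / 2 + κ * Dbar) / (L : ℝ) ^ 2 =
      -((∑ σ : Fin 2, μ σ) * (k / 2) / (L : ℝ) ^ 2) + κ * Dbar / (L : ℝ) ^ 2 := by
    ring
  rw [e3, ← hδL]
  linarith [hwin, hen, hop, heom']

end Finite

/-! ### §2  The equation-of-motion operator: translation sum of a number-conserving local word -/

section EomOperator

variable {L : ℕ} [NeZero L] {Λw : Finset (Site 2)}

/-- A translation sum `Σ_v T_v X` of an operator commuting with the particle number commutes with the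
particle number (the particle number is translation invariant). [folklore] -/
private theorem commute_sum_relabel_translate_totalNumber
    {X : Matrix (Finset (Orb (FermionTorus 2 L))) (Finset (Orb (FermionTorus 2 L))) ℂ}
    (hX : Commute X totalNumber) :
    Commute (∑ v : TorusSite 2 L, relabel (Orb.translate v) X) totalNumber := by
  refine Commute.sum_left _ _ _ fun v _ => ?_
  have hT : relabel (Orb.translate v) (totalNumber : Matrix (Finset (Orb (FermionTorus 2 L))) _ ℂ) =
      totalNumber := by
    rw [Orb.translate, relabel_mapEquiv_totalNumber]
  show relabel (Orb.translate v) X * totalNumber = totalNumber * relabel (Orb.translate v) X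
  rw [← hT, ← relabel_mul, hX.eq, relabel_mul]

/-- A translation sum of a Hermitian operator is Hermitian. [folklore] -/
private theorem isHermitian_sum_relabel_translate
    {X : Matrix (Finset (Orb (FermionTorus 2 L))) (Finset (Orb (FermionTorus 2 L))) ℂ}
    (hX : X.IsHermitian) : (∑ v : TorusSite 2 L, relabel (Orb.translate v) X).IsHermitian := by
  unfold Matrix.IsHermitian
  rw [conjTranspose_sum]
  refine Finset.sum_congr rfl fun v _ => ?_
  rw [← relabel_conjTranspose, hX.eq]

/-- **The eom operator splits into Hermitian number-conserving parts.** For a local `w ∈ 𝔄_{Λ_w}`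
commuting with the particle number of its window, the translation sum `W = Σ_v T_v Γ_L(w)` is
`B₁ + iB₂` with `B₁ = Σ_v T_v Γ_L(½(w + wᴴ))`, `B₂ = Σ_v T_v Γ_L((i/2)(wᴴ − w))` Hermitian and commuting
with the particle number of the torus. [cite: Han2020Bootstrap, §2] -/
theorem eom_translationSum_decomposition (h : Set.InjOn (Torus.proj (d := 2) L) ↑Λw)
    (wloc : FermionOp Λw) (hwN : Commute totalNumberOp wloc) :
    (∑ v : TorusSite 2 L, relabel (Orb.translate v)
        (fermionEmbed (PolySite.toTorusEmb L h) (((1 / 2 : ℂ)) • (wloc + wlocᴴ)))).IsHermitian ∧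
    (∑ v : TorusSite 2 L, relabel (Orb.translate v)
        (fermionEmbed (PolySite.toTorusEmb L h) ((I / 2 : ℂ) • (wlocᴴ - wloc)))).IsHermitian ∧
    Commute (∑ v : TorusSite 2 L, relabel (Orb.translate v)
        (fermionEmbed (PolySite.toTorusEmb L h) (((1 / 2 : ℂ)) • (wloc + wlocᴴ)))) totalNumber ∧
    Commute (∑ v : TorusSite 2 L, relabel (Orb.translate v)
        (fermionEmbed (PolySite.toTorusEmb L h) ((I / 2 : ℂ) • (wlocᴴ - wloc)))) totalNumber ∧
    (∑ v : TorusSite 2 L, relabel (Orb.translate v) (fermionEmbed (PolySite.toTorusEmb L h) wloc)) =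
      (∑ v : TorusSite 2 L, relabel (Orb.translate v)
        (fermionEmbed (PolySite.toTorusEmb L h) (((1 / 2 : ℂ)) • (wloc + wlocᴴ)))) +
      (I : ℂ) • (∑ v : TorusSite 2 L, relabel (Orb.translate v)
        (fermionEmbed (PolySite.toTorusEmb L h) ((I / 2 : ℂ) • (wlocᴴ - wloc)))) := by
  set Γ := fermionEmbed (PolySite.toTorusEmb L h) with hΓ
  set O₁ : FermionOp Λw := (1 / 2 : ℂ) • (wloc + wlocᴴ) with hO₁
  set O₂ : FermionOp Λw := (I / 2 : ℂ) • (wlocᴴ - wloc) with hO₂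
  -- local facts
  have hNh : (totalNumberOp : FermionOp Λw).IsHermitian := by
    rw [totalNumberOp_eq_totalNumber]; exact totalNumber_isHermitian
  have hwN' : Commute totalNumberOp wlocᴴ := by
    have h1 := congrArg conjTranspose hwN.eq
    rw [conjTranspose_mul, conjTranspose_mul, hNh.eq] at h1
    exact h1.symm
  have hO₁N : Commute totalNumberOp O₁ := (hwN.add_right hwN').smul_right _
  have hO₂N : Commute totalNumberOp O₂ := (hwN'.sub_right hwN).smul_right _
  have hO₁h : O₁.IsHermitian := by
    unfold Matrix.IsHermitian
    rw [hO₁, conjTranspose_smul, conjTranspose_add, conjTranspose_conjTranspose, add_comm]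
    congr 1
    simp
  have hO₂h : O₂.IsHermitian := by
    unfold Matrix.IsHermitian
    rw [hO₂, conjTranspose_smul, conjTranspose_sub, conjTranspose_conjTranspose]
    have hs : star (I / 2 : ℂ) = -(I / 2) := by
      simp [div_eq_mul_inv]
    rw [hs, neg_smul, ← smul_neg, neg_sub]
  -- embedded facts
  have hΓN : ∀ {O : FermionOp Λw}, Commute totalNumberOp O → Commute (Γ O) totalNumber := by
    intro O hO
    have h1 := commute_totalNumberOp_fermionEmbed (PolySite.toTorusEmb L h) hO
    rw [totalNumberOp_eq_totalNumber] at h1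
    exact h1.symm
  have hΓh : ∀ {O : FermionOp Λw}, O.IsHermitian → (Γ O).IsHermitian := by
    intro O hO
    unfold Matrix.IsHermitian
    rw [hΓ, ← fermionEmbed_conjTranspose, hO.eq]
  refine ⟨isHermitian_sum_relabel_translate (hΓh hO₁h), isHermitian_sum_relabel_translate (hΓh hO₂h),
    commute_sum_relabel_translate_totalNumber (hΓN hO₁N), commute_sum_relabel_translate_totalNumber (hΓN hO₂N),
    ?_⟩
  -- `w = O₁ + i O₂`
  have hw : wloc = O₁ + (I : ℂ) • O₂ := by
    rw [hO₁, hO₂, smul_smul, smul_add, smul_sub]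
    have hI : I * (I / 2) = -(1 / 2 : ℂ) := by
      rw [mul_div_assoc', I_mul_I, neg_div]
    rw [hI, neg_smul, neg_smul, sub_eq_add_neg, neg_neg]
    module
  conv_lhs => rw [hw]
  rw [Finset.smul_sum, ← Finset.sum_add_distrib]
  refine Finset.sum_congr rfl fun v _ => ?_
  rw [fermionEmbed_add, relabel_add, fermionEmbed_smul _ I, relabel_smul]

end EomOperator

end Summit.Ventures.CertifiedManyBodySolver.Observables

end
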